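import Literature.Analysis.FluidPDE.ReleaseLogBoundSmooth
import Literature.Analysis.FluidPDE.PassiveScalarExistenceProofs
import Literature.Analysis.FluidPDE.PassiveScalarLimitL2Drift
import Literature.Analysis.FluidPDE.PassiveScalarDriftApproxStrain
import Literature.Analysis.FluidPDE.PassiveScalarUniquenessL1Sobolev
import Literature.Analysis.FluidPDE.PassiveScalarWeakLscDissipation
import HarnessLib

/-!
# The logarithmic dissipation bound for releases (weak class)

Analysis/FluidPDE proof-support file (everything proved). **Batchelor's inequality for releases
at Sobolev level** in the DiPerna–Lions weak class: for every dimension, datum bounds `|h| ≤ H`,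
`‖∇h‖ ≤ L` and window bound `T₀` there are `κ₀ ∈ (0,1)` and `C ≥ 0` such that for `κ ≤ κ₀`,
`T ≤ T₀`, every drift `u ∈ L^∞(0,T; L²) ∩ L¹(0,T; Ḣ¹)` with `∫₀ᵀ ‖∇u‖_{L²} ≤ S` and every weak
solution `θ ∈ L^∞ₜL²ₓ` of `∂ₜθ + u·∇θ = κΔθ`, `θ(0) = h` (`Torus.IsWeakScalarTransportOn`):

  `κ ∫₀ᵀ ‖∇θ‖² ≤ C (S + 1) / log(1/κ)`   (`Torus.releaseLogBound`).

Proof: the smooth-drift theorem `Torus.releaseLogBound_smooth` (two-point / reversed-kernel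
argument) applied to the strain-controlled space–time mollifications of the drift
(`exists_smooth_isDivFree_tendsto_eLpNorm_sub_strain`); the classical solutions are bounded in
`L^∞ₜL²ₓ`, a subsequence converges weakly to a weak solution for the limit drift
(`IsWeakScalarTransportOn.of_tendsto_of_lintegral_sq_le`), which is the given one by DiPerna–Lions uniqueness
for `L¹ₜḢ¹ₓ` drifts (`unique_of_lintegral_eGradNormSq_rpow_lt_top`), and the dissipation is
weakly lower semicontinuous (`lintegral_eScalarGradNormSq_le_liminf_of_weakLimit`).

## References

* G. Crippa, C. De Lellis, J. reine angew. Math. 616 (2008), 15–46 (logarithmic estimate).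
* C. Seis, arXiv:2003.08794, Lemma 3 / Rmk. 1. [`Seis2022`]
* R. J. DiPerna, P.-L. Lions, Invent. Math. 98 (1989), §II.3–II.4. [`DiPernaLions1989`]
-/

noncomputable section

open MeasureTheory Set Function Filter Topology UnitAddTorus
open scoped ENNReal NNReal InnerProductSpace
open Literature.Analysis.FunctionSpaces Literature.Analysis.FunctionSpaces.Torus

namespace Literature.Analysis.FluidPDE

namespace Torus

variable {d : Type*} [Fintype d]

/-- `eScalarGradNormSq` only depends on the a.e. class of the slice. [folklore] -/
theorem eScalarGradNormSq_congr_ae_eq {f g : UnitAddTorus d → ℝ} (h : f =ᵐ[volume] g) :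
    eScalarGradNormSq f = eScalarGradNormSq g := by
  rw [eScalarGradNormSq_eq_tsum, eScalarGradNormSq_eq_tsum]
  congr 1
  refine tsum_congr fun k => ?_
  have e : mFourierCoeff (fun x => (f x : ℂ)) k = mFourierCoeff (fun x => (g x : ℂ)) k := by
    rw [mFourierCoeff_eq_integral_volume, mFourierCoeff_eq_integral_volume]
    refine integral_congr_ae ?_
    filter_upwards [h] with x hx
    rw [hx]
  rw [e]

/-- **The logarithmic dissipation bound for releases** (Batchelor's inequality at Sobolev level,
weak class): for `κ ≤ κ₀`, `T ≤ T₀`, a drift `u ∈ L^∞ₜL²ₓ` with `∫₀ᵀ ‖∇u‖_{L²} ≤ S` and a weak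
solution `θ` of `∂ₜθ + u·∇θ = κΔθ`, `θ(0) = h` with `|h| ≤ H`, `‖∇h‖ ≤ L` smooth:
`κ∫₀ᵀ‖∇θ‖² ≤ C(S+1)/log(1/κ)`. [cite: Seis2022, Lemma 3 and Rmk. 1] -/
theorem releaseLogBound [DecidableEq d] (H L T₀ : ℝ) (hT₀ : 0 < T₀) :
    ∃ κ₀ C : ℝ, 0 < κ₀ ∧ κ₀ < 1 ∧ 0 ≤ C ∧
      ∀ (κ T S : ℝ) (u : ℝ → UnitAddTorus d → EuclideanSpace ℝ d) (h : UnitAddTorus d → ℝ)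
        (θ : ℝ → UnitAddTorus d → ℝ),
        0 < κ → κ ≤ κ₀ → 0 < T → T ≤ T₀ → 0 ≤ S →
        (∃ M : ℝ≥0, ∀ᵐ t ∂(volume.restrict (Ioo 0 T)), ∫⁻ x, ‖u t x‖ₑ ^ 2 ≤ M) →
        ∫⁻ t in Ioo 0 T, FunctionSpaces.Torus.eGradNormSq (u t) ^ (1 / 2 : ℝ) ≤ ENNReal.ofReal S →
        FunctionSpaces.Torus.IsSmooth h → (∀ x, |h x| ≤ H) → (∀ x, ‖FunctionSpaces.Torus.gradient h x‖ ≤ L) →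
        IsWeakScalarTransportOn T κ u h θ →
        eScalarDissipation κ θ 0 T ≤ ENNReal.ofReal (C * (S + 1) / Real.log κ⁻¹) := by
  classical
  obtain ⟨κ₀, C, hκ₀, hκ₀1, hC, hsm⟩ := releaseLogBound_smooth (d := d) H L T₀ hT₀
  refine ⟨κ₀, C, hκ₀, hκ₀1, hC, ?_⟩
  intro κ T S u h θ hκ hκ0 hT hTT₀ hS0 hM hS hh hH hL hθ
  obtain ⟨M, hM⟩ := hM
  set bound : ℝ≥0∞ := ENNReal.ofReal (C * (S + 1) / Real.log κ⁻¹) with hbound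
  -- the drift: class data
  have hum : AEStronglyMeasurable (FunctionSpaces.Torus.stLift u) (volume.restrict (Ioo 0 T ×ˢ univ)) := hθ.aestronglyMeasurable_velocity
  have hdiv : ∀ᵐ t ∂(volume.restrict (Ioo 0 T)), FunctionSpaces.Torus.IsWeaklyDivFree (u t) := hθ.ae_isWeaklyDivFree
  have hu2 : ∫⁻ t in Ioo 0 T, ∫⁻ x, ‖u t x‖ₑ ^ 2 < ⊤ := by
    calc ∫⁻ t in Ioo 0 T, ∫⁻ x, ‖u t x‖ₑ ^ 2 ≤ ∫⁻ _ in Ioo (0 : ℝ) T, (M : ℝ≥0∞) := lintegral_mono_ae hM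
      _ < ⊤ := by
          rw [lintegral_const, Measure.restrict_apply_univ]
          exact ENNReal.mul_lt_top ENNReal.coe_lt_top measure_Ioo_lt_top
  have hSfin : ∫⁻ t in Ioo 0 T, FunctionSpaces.Torus.eGradNormSq (u t) ^ (1 / 2 : ℝ) < ⊤ := lt_of_le_of_lt hS ENNReal.ofReal_lt_top
  -- strain-controlled smooth approximation of the drift
  obtain ⟨v, hvs, hvdiv, hvlim, hvS⟩ := exists_smooth_isDivFree_tendsto_eLpNorm_sub_strain hum hu2 hdiv
  -- classical solutions with the regularised drifts and the datum `h`
  have hcl : ∀ n, ∃ ϑ : ℝ → UnitAddTorus d → ℝ, IsClassicalScalarTransportOn (Icc 0 T) κ (v n) ϑ ∧ ϑ 0 = h := by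
    intro n
    obtain ⟨ϑ, hϑ, h0, -⟩ := exists_unique_isClassicalScalarTransportOn_of_forced
      exists_unique_isClassicalScalarTransportForcedOn_holds hκ hT
      (FunctionSpaces.Torus.isSmoothSpaceTimeOn_of_contDiff (hvs n) _) (fun t _ => hvdiv n t) hh
    exact ⟨ϑ, hϑ, h0⟩
  choose ϑ hϑ hϑ0 using hcl
  -- the smooth-drift bound for each approximation
  have hbn : ∀ n, eScalarDissipation κ (ϑ n) 0 T ≤ bound := fun n =>
    hsm κ T S (v n) h (ϑ n) hκ hκ0 hT hTT₀ hS0 ((hvS n).trans hS) hh hH hL (hϑ n) (hϑ0 n)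
  -- they are weak solutions with datum `h`, bounded in `L^∞ₜ L²ₓ`
  have hsol : ∀ n, IsWeakScalarTransportOn T κ (v n) h (ϑ n) := by
    intro n
    have h1 := IsClassicalScalarTransportOn.isWeakScalarTransportOn_holds (hϑ n) subset_rfl
    rwa [hϑ0 n] at h1
  have hh2 : MemLp h 2 volume := hh.memLp 2
  -- the a priori bound `∫ |ϑₙ(t)|² ≤ ‖h‖₂²`
  set C0 : ℝ≥0 := (eLpNorm h 2 volume ^ 2).toNNReal with hC0
  have hC0eq : (C0 : ℝ≥0∞) = eLpNorm h 2 volume ^ 2 := ENNReal.coe_toNNReal (ENNReal.pow_ne_top hh2.eLpNorm_ne_top)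
  have hbd' : ∀ n, ∀ t ∈ Icc 0 T, ∫⁻ x, ‖ϑ n t x‖ₑ ^ 2 ≤ C0 := by
    intro n t ht
    have hθc : Continuous (ϑ n t) := ((hϑ n).smooth_scalar.isSmooth_slice ht).continuous
    have hE := IsClassicalScalarTransportOn.scalarL2Sq_add_scalarDissipation_holds (hϑ n) ht.1 (Icc_subset_Icc_right ht.2)
    have hDn := scalarDissipation_nonneg hκ.le (ϑ n) ht.1
    have hle : scalarL2Sq (ϑ n t) ≤ scalarL2Sq h := by rw [← hϑ0 n]; linarith
    calc ∫⁻ x, ‖ϑ n t x‖ₑ ^ 2 = ENNReal.ofReal (scalarL2Sq (ϑ n t)) := lintegral_enorm_sq_eq_ofReal_integral_sq hθc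
      _ ≤ ENNReal.ofReal (scalarL2Sq h) := ENNReal.ofReal_le_ofReal hle
      _ = eLpNorm h 2 volume ^ 2 := by
          rw [scalarL2Sq, ← lintegral_enorm_sq_eq_ofReal_integral_sq hh.continuous, FunctionSpaces.eLpNorm_two_pow_two_eq_lintegral]
      _ = C0 := hC0eq.symm
  have hbd : ∀ n, ∀ᵐ t ∂(volume.restrict (Ioo 0 T)), ∫⁻ x, ‖ϑ n t x‖ₑ ^ 2 ≤ C0 := fun n =>
    (ae_restrict_mem measurableSet_Ioo).mono fun t ht => hbd' n t (Ioo_subset_Icc_self ht)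
  -- weak-* compactness, identification of the limit, uniqueness
  obtain ⟨φ, hφ, W, hWm, hWb, hWlim⟩ :=
    FunctionSpaces.Torus.exists_strictMono_weakLimit_of_lintegral_sq_le (fun n => (hsol n).aestronglyMeasurable) hbd
  have hW : IsWeakScalarTransportOn T κ u h W :=
    IsWeakScalarTransportOn.of_tendsto_of_lintegral_sq_le (fun j => hsol (φ j)) (fun j => hbd (φ j)) hWm hWb hWlim hum hM hdiv
      (hvlim.comp hφ.tendsto_atTop) hh2 (fun _ => hh2) (by simp only [sub_self, eLpNorm_zero]; exact tendsto_const_nhds)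
  have hae : ∀ᵐ t ∂(volume.restrict (Ioo 0 T)), θ t =ᵐ[volume] W t :=
    IsWeakScalarTransportOn.unique_of_lintegral_eGradNormSq_rpow_lt_top hκ hθ hW hSfin
  have hD : eScalarDissipation κ θ 0 T = eScalarDissipation κ W 0 T := by
    simp only [eScalarDissipation]
    congr 1
    exact lintegral_congr_ae (hae.mono fun t ht => eScalarGradNormSq_congr_ae_eq ht)
  -- weak lower semicontinuity of the dissipation
  have hlsc := lintegral_eScalarGradNormSq_le_liminf_of_weakLimit (fun j => (hsol (φ j)).aestronglyMeasurable)
    (fun j => hbd (φ j)) hWm hWb hWlim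
  rw [hD, eScalarDissipation]
  calc ENNReal.ofReal κ * ∫⁻ t in Ioo 0 T, eScalarGradNormSq (W t)
      ≤ ENNReal.ofReal κ * liminf (fun j => ∫⁻ t in Ioo 0 T, eScalarGradNormSq (ϑ (φ j) t)) atTop :=
        mul_le_mul_right hlsc _
    _ ≤ liminf (fun j => ENNReal.ofReal κ * ∫⁻ t in Ioo 0 T, eScalarGradNormSq (ϑ (φ j) t)) atTop :=
        ENNReal.mul_liminf_le _ _
    _ ≤ bound := liminf_le_of_frequently_le' (Frequently.of_forall fun j => hbn (φ j))

end Torus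

end Literature.Analysis.FluidPDE
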